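import Summits.ResolutionOfSingularities.ResolutionOfSingularities.Theorems.WeightedInvariantContactCylinderOpenClause
import Summits.ResolutionOfSingularities.ResolutionOfSingularities.Theorems.WeightedInvariantContactCylinderDescent
import HarnessLib

/-!
# The (open″) clause body at P3a positions FROM REGIME DATA — descent composed with the open clause (ORDER (o28), (P3a-9))
# (door `HypersurfaceCentreConstruction`, stmt-ResolutionOfSingularities-19897; KEY `stub_localWeightedDropEFT4S`, regime P3a)

Topic: `Summits/ResolutionOfSingularities/ResolutionOfSingularities/Theorems`. Helper for the door item
`HypersurfaceCentreConstruction` (stmt-ResolutionOfSingularities-19897, route `WeightedInvariant`), line `local-engine` of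
res-L1-w43-plan-1 (L W4.3), ORDER (o28) (lead res-type-005, co-hand res-D-brk-1).

The (open″) body of p528319 (`jOpenPresentation_body_cylinder_iotaOrd`) ASSUMED a pair `(x, g) ⊆ A` presenting the cylinder
(`g/1` a terminal contact parameter of `F/1` in `A_𝔭`).  MAXIMISER DESCENT (p532512, `Descent.exists_pair_maximiser`) produces
such a pair inside the local ring `A_𝔪` from the REGIME DATA alone; this file clears denominators and composes: at a model
position `(A, 𝔪, F)` of regime P3a — `𝔭 ≤ 𝔪` primes, `A_𝔪` and `A_𝔭` regular, `dim A_𝔭 = 2`, the stratum `V(𝔭)` a regular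
CURVE at `𝔪` cut out by a pair `(x, g₀) ⊆ A` (`(x, g₀) A_𝔪 = 𝔭 A_𝔪`, independent differentials in `A_𝔪`, `dim A_𝔪 ⧸ 𝔭A_𝔪 = 1`),
`F/1 ≠ 0` NOT of monomial type in `A_𝔭`, `F/1 ∈ 𝔪² A_𝔪`, and the local (strat) conjunct for `iotaOrd` at `A_𝔪` with centre
`𝔭 A_𝔪` — there are NUMERATORS `x', g' ∈ A` of a descended pair for which the full (open″) body holds:
`U = ![x', g']`, `W = ![1, b_max]`.  No maximiser hypothesis remains.

## Contents (sorry-free, standard axioms; NO definitions)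

* `span_pair_unit_mul`, `linearIndependent_toCotangent_pair_unit_mul` — unit multiples keep the span and the independence.
* **`jOpenPresentation_body_cylinder_iotaOrd_of_regime`** — the statement above.

[OURS · L1 W4.3 · (o28) P3a]  Replaces the role of NO printed item; NOT a statement of the manuscript
[claim: Hironaka2017, status: under-review]. AI work, weaker than expert review.  Pure commutative algebra; no named facts.

## References

* H. Matsumura, *Commutative Ring Theory* (1987), Thm. 4.3, 11.2, 14.2. [Matsumura1987]
* V. Cossart, O. Piltant, J. Algebra 320 (2008), Prop. 4.2 (proof). [CossartPiltant2008]
* res-L1-w43-plan-1, `L/res-L1-w43-plan-1/IOTA3-DESIGN.md` v1 §3 P3a (OURS, AI planning).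
-/

noncomputable section

open IsLocalRing Literature.AlgebraicGeometry.Resolution
open Summit.ResolutionOfSingularities.ResolutionOfSingularities.Cruxes.HypersurfaceCentreConstruction.LocalEngine

set_option linter.dupNamespace false -- mandated namespace of this single-conjunct summit

namespace Summit.ResolutionOfSingularities.ResolutionOfSingularities.Theorems

namespace ContactCylinder

/-! ## Unit multiples -/

/-- `(u a, v b) = (a, b)` for units `u, v`. [folklore] -/
theorem span_pair_unit_mul {R : Type} [CommRing R] {u v : R} (hu : IsUnit u) (hv : IsUnit v) (a b : R) :
    Ideal.span {u * a, v * b} = Ideal.span {a, b} := by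
  rw [Ideal.span_insert, Ideal.span_insert, Ideal.span_singleton_mul_left_unit hu, Ideal.span_singleton_mul_left_unit hv]

/-- Unit multiples keep the independence of differentials of a pair. [folklore] -/
theorem linearIndependent_toCotangent_pair_unit_mul {R : Type} [CommRing R] [IsLocalRing R] {x g u v : R}
    (hu : IsUnit u) (hv : IsUnit v) (hxg : ∀ i, (![x, g] : Fin 2 → R) i ∈ maximalIdeal R)
    (hli : LinearIndependent (ResidueField R) (fun i => (maximalIdeal R).toCotangent ⟨(![x, g] : Fin 2 → R) i, hxg i⟩))
    (hxg' : ∀ i, (![u * x, v * g] : Fin 2 → R) i ∈ maximalIdeal R) :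
    LinearIndependent (ResidueField R) (fun i => (maximalIdeal R).toCotangent ⟨(![u * x, v * g] : Fin 2 → R) i, hxg' i⟩) := by
  rw [linearIndependent_toCotangent_iff_forall_mem] at hli ⊢
  intro r hr
  simp only [Fin.sum_univ_two, Matrix.cons_val_zero, Matrix.cons_val_one] at hr
  have hr' : ∑ i, (![r 0 * u, r 1 * v] : Fin 2 → R) i * (![x, g] : Fin 2 → R) i ∈ maximalIdeal R ^ 2 := by
    simp only [Fin.sum_univ_two, Matrix.cons_val_zero, Matrix.cons_val_one]
    have : r 0 * u * x + r 1 * v * g = r 0 * (u * x) + r 1 * (v * g) := by ring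
    rw [this]
    exact hr
  have h := hli _ hr'
  have h0 : r 0 * u ∈ maximalIdeal R := by simpa using h 0
  have h1 : r 1 * v ∈ maximalIdeal R := by simpa using h 1
  refine Fin.forall_fin_two.2 ⟨?_, ?_⟩
  · exact ((Ideal.IsPrime.mul_mem_iff_mem_or_mem inferInstance).mp h0).resolve_right
      (fun h => (IsLocalRing.mem_maximalIdeal _).mp h hu)
  · exact ((Ideal.IsPrime.mul_mem_iff_mem_or_mem inferInstance).mp h1).resolve_right
      (fun h => (IsLocalRing.mem_maximalIdeal _).mp h hv)

/-! ## The (open″) body from regime data -/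

/-- **(open″) BODY AT A P3a POSITION FROM REGIME DATA** for the pair `(iotaOrd, jCylinder iotaOrd jContact)`.  `k` perfect,
`A` of finite type, `𝔭 ≤ 𝔪` primes with `A_𝔪`, `A_𝔭` regular, `dim A_𝔭 = 2`; `(x, g₀) ⊆ A` cutting out the stratum at `𝔪`:
`(x, g₀) A_𝔪 = 𝔭 A_𝔪`, independent differentials in `A_𝔪`, `dim A_𝔪 ⧸ 𝔭 A_𝔪 = 1` (a regular curve); `F/1 ≠ 0` NOT of monomial
type in `A_𝔭`, `F/1 ∈ 𝔪² A_𝔪`; the local (strat) conjunct for `iotaOrd` at `A_𝔪` with centre `𝔭 A_𝔪`.  Then for NUMERATORS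
`x', g' ∈ A` of a descended maximiser pair (`Descent.exists_pair_maximiser`, read in `(A_𝔪)_{𝔭A_𝔪} ≃ A_𝔭`) the (open″) body holds:
some `h ∉ 𝔪` with, for every prime `𝔮 ∌ h`, `(x' ∈ 𝔮 ∧ g' ∈ 𝔮) ↔ (F ∈ 𝔪_{A_𝔮}² ∧ ord_𝔮 F = ord_𝔪 F)` and then
`jCylinder iotaOrd jContact (A_𝔮) (F/1) m = (x', g'; 1, b_max)_m · A_𝔮` — and `(x', g') A_𝔪 = 𝔭 A_𝔪` with independent differentials.
[OURS · L1 W4.3 · (o28) (P3a-9)] -/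
theorem jOpenPresentation_body_cylinder_iotaOrd_of_regime
    (k : Type) [Field k] [PerfectField k] (A : Type) [CommRing A] [Algebra k A] [Algebra.FiniteType k A]
    (𝔪 : Ideal A) [𝔪.IsPrime] [h𝔪 : IsRegularLocalRing (Localization.AtPrime 𝔪)] (F : A)
    (hF2𝔪 : algebraMap A (Localization.AtPrime 𝔪) F ∈ maximalIdeal (Localization.AtPrime 𝔪) ^ 2)
    (𝔭 : Ideal A) [𝔭.IsPrime] (h𝔭𝔪 : 𝔭 ≤ 𝔪) [IsRegularLocalRing (Localization.AtPrime 𝔭)]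
    (hdim𝔭 : ringKrullDim (Localization.AtPrime 𝔭) = 2) (x g₀ : A)
    (hxg𝔪 : (Ideal.span {x, g₀}).map (algebraMap A (Localization.AtPrime 𝔪)) = 𝔭.map (algebraMap A (Localization.AtPrime 𝔪)))
    (hU𝔪 : ∀ i, algebraMap A (Localization.AtPrime 𝔪) ((![x, g₀] : Fin 2 → A) i) ∈ maximalIdeal (Localization.AtPrime 𝔪))
    (hli𝔪 : LinearIndependent (ResidueField (Localization.AtPrime 𝔪)) fun i =>
      (maximalIdeal (Localization.AtPrime 𝔪)).toCotangent ⟨algebraMap A _ ((![x, g₀] : Fin 2 → A) i), hU𝔪 i⟩)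
    (hdim1 : ringKrullDim (Localization.AtPrime 𝔪 ⧸ 𝔭.map (algebraMap A (Localization.AtPrime 𝔪))) = 1)
    (hF0 : algebraMap A (Localization.AtPrime 𝔭) F ≠ 0)
    (hnm : ¬ IsMonomialType (algebraMap A (Localization.AtPrime 𝔭) F))
    (hstrat : ∀ (𝔭' : Ideal (Localization.AtPrime 𝔪)) [𝔭'.IsPrime],
      algebraMap A (Localization.AtPrime 𝔪) F ∈ 𝔭' →
        (iotaOrd (Localization.AtPrime 𝔭') (algebraMap (Localization.AtPrime 𝔪) (Localization.AtPrime 𝔭')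
            (algebraMap A (Localization.AtPrime 𝔪) F)) =
          iotaOrd (Localization.AtPrime 𝔪) (algebraMap A (Localization.AtPrime 𝔪) F) ↔
            𝔭.map (algebraMap A (Localization.AtPrime 𝔪)) ≤ 𝔭')) :
    ∃ x' g' : A,
      (Ideal.span {x', g'}).map (algebraMap A (Localization.AtPrime 𝔪)) = 𝔭.map (algebraMap A (Localization.AtPrime 𝔪)) ∧
      (∃ hU : ∀ i, algebraMap A (Localization.AtPrime 𝔪) ((![x', g'] : Fin 2 → A) i) ∈ maximalIdeal (Localization.AtPrime 𝔪),
        LinearIndependent (ResidueField (Localization.AtPrime 𝔪)) fun i =>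
          (maximalIdeal (Localization.AtPrime 𝔪)).toCotangent ⟨algebraMap A _ ((![x', g'] : Fin 2 → A) i), hU i⟩) ∧
      ∃ h : A, h ∉ 𝔪 ∧ 1 ≤ bMax (algebraMap A (Localization.AtPrime 𝔭) F) ∧
      ∀ (𝔮 : Ideal A) [𝔮.IsPrime], h ∉ 𝔮 →
        ((∀ i, (![x', g'] : Fin 2 → A) i ∈ 𝔮) ↔
          (algebraMap A (Localization.AtPrime 𝔮) F ∈ maximalIdeal (Localization.AtPrime 𝔮) ^ 2 ∧
            iotaOrd (Localization.AtPrime 𝔮) (algebraMap A (Localization.AtPrime 𝔮) F) =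
              iotaOrd (Localization.AtPrime 𝔪) (algebraMap A (Localization.AtPrime 𝔪) F))) ∧
        ((∀ i, (![x', g'] : Fin 2 → A) i ∈ 𝔮) → ∀ m : ℕ,
          jCylinder iotaOrd jContact (Localization.AtPrime 𝔮) (algebraMap A (Localization.AtPrime 𝔮) F) m =
            (weightedMonomialIdeal ![x', g'] ![1, bMax (algebraMap A (Localization.AtPrime 𝔭) F)] m).map
              (algebraMap A (Localization.AtPrime 𝔮))) := by
  -- `(Localization.AtPrime 𝔪) = A_𝔪`, `(Ideal.map (algebraMap A (Localization.AtPrime 𝔪)) 𝔭) = 𝔭 A_𝔪`, `(Localization.AtPrime (Ideal.map (algebraMap A (Localization.AtPrime 𝔪)) 𝔭)) = S_P ≃ A_𝔭` over `A`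
  haveI hPprime : (𝔭.map (algebraMap A (Localization.AtPrime 𝔪))).IsPrime := isPrime_map_atPrime_of_le 𝔭 𝔪 h𝔭𝔪
  haveI := isLocalizationAtPrime_atPrime_map 𝔭 𝔪 h𝔭𝔪
  haveI : IsRegularLocalRing (Localization.AtPrime (Ideal.map (algebraMap A (Localization.AtPrime 𝔪)) 𝔭)) := isRegularLocalRing_localization_atPrime (Localization.AtPrime 𝔪) (Ideal.map (algebraMap A (Localization.AtPrime 𝔪)) 𝔭)
  let e : (Localization.AtPrime (Ideal.map (algebraMap A (Localization.AtPrime 𝔪)) 𝔭)) ≃+* Localization.AtPrime 𝔭 := (IsLocalization.algEquiv 𝔭.primeCompl (Localization.AtPrime (Ideal.map (algebraMap A (Localization.AtPrime 𝔪)) 𝔭)) (Localization.AtPrime 𝔭)).toRingEquiv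
  have he : ∀ a : A, e (algebraMap A (Localization.AtPrime (Ideal.map (algebraMap A (Localization.AtPrime 𝔪)) 𝔭)) a) = algebraMap A (Localization.AtPrime 𝔭) a := fun a =>
    (IsLocalization.algEquiv 𝔭.primeCompl (Localization.AtPrime (Ideal.map (algebraMap A (Localization.AtPrime 𝔪)) 𝔭)) (Localization.AtPrime 𝔭)).commutes a
  have htower : ∀ a : A, algebraMap A (Localization.AtPrime (Ideal.map (algebraMap A (Localization.AtPrime 𝔪)) 𝔭)) a = algebraMap (Localization.AtPrime 𝔪) (Localization.AtPrime (Ideal.map (algebraMap A (Localization.AtPrime 𝔪)) 𝔭)) (algebraMap A (Localization.AtPrime 𝔪) a) := fun a =>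
    IsScalarTower.algebraMap_apply A (Localization.AtPrime 𝔪) (Localization.AtPrime (Ideal.map (algebraMap A (Localization.AtPrime 𝔪)) 𝔭)) a
  -- the pair read in `(Localization.AtPrime 𝔪)`
  have hxgS : ∀ i, (![algebraMap A (Localization.AtPrime 𝔪) x, algebraMap A (Localization.AtPrime 𝔪) g₀] : Fin 2 → (Localization.AtPrime 𝔪)) i ∈ maximalIdeal (Localization.AtPrime 𝔪) := by
    intro i; fin_cases i
    · exact hU𝔪 0
    · exact hU𝔪 1
  have hliS : LinearIndependent (ResidueField (Localization.AtPrime 𝔪)) (fun i => (maximalIdeal (Localization.AtPrime 𝔪)).toCotangent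
      ⟨(![algebraMap A (Localization.AtPrime 𝔪) x, algebraMap A (Localization.AtPrime 𝔪) g₀] : Fin 2 → (Localization.AtPrime 𝔪)) i, hxgS i⟩) := by
    have hfun : (fun i => (maximalIdeal (Localization.AtPrime 𝔪)).toCotangent ⟨algebraMap A (Localization.AtPrime 𝔪) ((![x, g₀] : Fin 2 → A) i), hU𝔪 i⟩) =
        (fun i => (maximalIdeal (Localization.AtPrime 𝔪)).toCotangent ⟨(![algebraMap A (Localization.AtPrime 𝔪) x, algebraMap A (Localization.AtPrime 𝔪) g₀] : Fin 2 → (Localization.AtPrime 𝔪)) i, hxgS i⟩) := by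
      funext i; fin_cases i <;> rfl
    rw [← hfun]; exact hli𝔪
  have hPS : Ideal.span {algebraMap A (Localization.AtPrime 𝔪) x, algebraMap A (Localization.AtPrime 𝔪) g₀} = (Ideal.map (algebraMap A (Localization.AtPrime 𝔪)) 𝔭) := by
    rw [← hxg𝔪, Ideal.map_span, Set.image_pair]
  -- `F` in `(Localization.AtPrime (Ideal.map (algebraMap A (Localization.AtPrime 𝔪)) 𝔭))`: non-zero, not of monomial type, order `ν`; equimultiplicity from (strat)
  have hFR : algebraMap (Localization.AtPrime 𝔪) (Localization.AtPrime (Ideal.map (algebraMap A (Localization.AtPrime 𝔪)) 𝔭)) (algebraMap A (Localization.AtPrime 𝔪) F) = algebraMap A (Localization.AtPrime (Ideal.map (algebraMap A (Localization.AtPrime 𝔪)) 𝔭)) F := (htower F).symm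
  have hf0R : algebraMap (Localization.AtPrime 𝔪) (Localization.AtPrime (Ideal.map (algebraMap A (Localization.AtPrime 𝔪)) 𝔭)) (algebraMap A (Localization.AtPrime 𝔪) F) ≠ 0 := by
    rw [hFR]; intro h; exact hF0 (by rw [← he F, h, map_zero])
  have hnmR : ¬ IsMonomialType (algebraMap (Localization.AtPrime 𝔪) (Localization.AtPrime (Ideal.map (algebraMap A (Localization.AtPrime 𝔪)) 𝔭)) (algebraMap A (Localization.AtPrime 𝔪) F)) := by
    rw [hFR]; intro h; exact hnm (he F ▸ (isMonomialType_ringEquiv_iff e _).mpr h)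
  -- `(x, g₀)` read in `A_𝔭`: an r.s.p., so `F ∈ 𝔭`
  have hmaxR : Ideal.span {algebraMap (Localization.AtPrime 𝔪) (Localization.AtPrime (Ideal.map (algebraMap A (Localization.AtPrime 𝔪)) 𝔭)) (algebraMap A (Localization.AtPrime 𝔪) x), algebraMap (Localization.AtPrime 𝔪) (Localization.AtPrime (Ideal.map (algebraMap A (Localization.AtPrime 𝔪)) 𝔭)) (algebraMap A (Localization.AtPrime 𝔪) g₀)} = maximalIdeal (Localization.AtPrime (Ideal.map (algebraMap A (Localization.AtPrime 𝔪)) 𝔭)) := by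
    rw [← Localization.AtPrime.map_eq_maximalIdeal,
      show Ideal.map (algebraMap (Localization.AtPrime 𝔪) (Localization.AtPrime (Ideal.map (algebraMap A (Localization.AtPrime 𝔪)) 𝔭)))
          (Ideal.map (algebraMap A (Localization.AtPrime 𝔪)) 𝔭) =
        Ideal.map (algebraMap (Localization.AtPrime 𝔪) (Localization.AtPrime (Ideal.map (algebraMap A (Localization.AtPrime 𝔪)) 𝔭)))
          (Ideal.span {algebraMap A (Localization.AtPrime 𝔪) x, algebraMap A (Localization.AtPrime 𝔪) g₀}) by rw [hPS],
      Ideal.map_span, Set.image_pair]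
  have hxg' : Ideal.span {algebraMap A (Localization.AtPrime 𝔭) x, algebraMap A (Localization.AtPrime 𝔭) g₀} =
      maximalIdeal (Localization.AtPrime 𝔭) := by
    rw [← he x, ← he g₀, htower x, htower g₀, ← Set.image_pair, ← Ideal.map_span, hmaxR, map_ringEquiv_maximalIdeal]
  have hg2 := (LocalGameEFTSteepening.not_mem_sq_of_span_pair_eq (by exact_mod_cast hdim𝔭) hxg').2
  have hF2𝔭 := mem_sq_of_not_isMonomialType hF0 hnm ⟨_, hxg' ▸ Ideal.subset_span (by simp), hg2⟩
  have hF𝔭 : F ∈ 𝔭 :=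
    (IsLocalization.AtPrime.to_map_mem_maximal_iff (Localization.AtPrime 𝔭) 𝔭 F).mp (Ideal.pow_le_self two_ne_zero hF2𝔭)
  have heqS : algebraMap A (Localization.AtPrime 𝔪) F ∉ maximalIdeal (Localization.AtPrime 𝔪) ^ ((adicOrder (algebraMap (Localization.AtPrime 𝔪) (Localization.AtPrime (Ideal.map (algebraMap A (Localization.AtPrime 𝔪)) 𝔭)) (algebraMap A (Localization.AtPrime 𝔪) F))).toNat + 1) := by
    have hg₀R : algebraMap (Localization.AtPrime 𝔪) (Localization.AtPrime (Ideal.map (algebraMap A (Localization.AtPrime 𝔪)) 𝔭)) (algebraMap A (Localization.AtPrime 𝔪) g₀) ∈ maximalIdeal (Localization.AtPrime (Ideal.map (algebraMap A (Localization.AtPrime 𝔪)) 𝔭)) := hmaxR ▸ Ideal.subset_span (by simp)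
    have hg₀R2 : algebraMap (Localization.AtPrime 𝔪) (Localization.AtPrime (Ideal.map (algebraMap A (Localization.AtPrime 𝔪)) 𝔭)) (algebraMap A (Localization.AtPrime 𝔪) g₀) ∉ maximalIdeal (Localization.AtPrime (Ideal.map (algebraMap A (Localization.AtPrime 𝔪)) 𝔭)) ^ 2 :=
      (Descent.pair_facts (Ideal.map (algebraMap A (Localization.AtPrime 𝔪)) 𝔭) hxgS hliS hPS).2.1
    obtain ⟨ν, -, hνnat, -, hFν, hford⟩ := exists_adicOrder_eq_of_not_isMonomialType hf0R hnmR ⟨_, hg₀R, hg₀R2⟩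
    rw [hνnat]
    have hιR : iotaOrd (Localization.AtPrime (Ideal.map (algebraMap A (Localization.AtPrime 𝔪)) 𝔭)) (algebraMap (Localization.AtPrime 𝔪) (Localization.AtPrime (Ideal.map (algebraMap A (Localization.AtPrime 𝔪)) 𝔭)) (algebraMap A (Localization.AtPrime 𝔪) F)) = ν := (iotaOrd_eq_natCast_iff (Localization.AtPrime (Ideal.map (algebraMap A (Localization.AtPrime 𝔪)) 𝔭)) _ ν).mpr ⟨hFν, hford⟩
    have hιS : iotaOrd (Localization.AtPrime 𝔪) (algebraMap A (Localization.AtPrime 𝔪) F) = ν := by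
      rw [← hιR]; exact ((hstrat (Ideal.map (algebraMap A (Localization.AtPrime 𝔪)) 𝔭) (Ideal.mem_map_of_mem _ hF𝔭)).mpr le_rfl).symm
    exact ((iotaOrd_eq_natCast_iff (Localization.AtPrime 𝔪) _ ν).mp hιS).2
  -- MAXIMISER DESCENT in `(Localization.AtPrime 𝔪)`
  obtain ⟨hbR, xS, gS, hPS', hxgS', hliS', hreachS⟩ :=
    Descent.exists_pair_maximiser_of_essFiniteType (Ideal.map (algebraMap A (Localization.AtPrime 𝔪)) 𝔭) k hdim1 hxgS hliS hPS hf0R hnmR heqS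
  -- numerators in `A`
  obtain ⟨⟨a₁, s₁⟩, h₁⟩ := IsLocalization.surj 𝔪.primeCompl xS
  obtain ⟨⟨a₂, s₂⟩, h₂⟩ := IsLocalization.surj 𝔪.primeCompl gS
  have hu₁ : IsUnit (algebraMap A (Localization.AtPrime 𝔪) (s₁ : A)) := IsLocalization.map_units (Localization.AtPrime 𝔪) s₁
  have hu₂ : IsUnit (algebraMap A (Localization.AtPrime 𝔪) (s₂ : A)) := IsLocalization.map_units (Localization.AtPrime 𝔪) s₂
  have ha₁ : algebraMap A (Localization.AtPrime 𝔪) a₁ = algebraMap A (Localization.AtPrime 𝔪) (s₁ : A) * xS := by rw [← h₁, mul_comm]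
  have ha₂ : algebraMap A (Localization.AtPrime 𝔪) a₂ = algebraMap A (Localization.AtPrime 𝔪) (s₂ : A) * gS := by rw [← h₂, mul_comm]
  have hUa : ∀ i, algebraMap A (Localization.AtPrime 𝔪) ((![a₁, a₂] : Fin 2 → A) i) ∈ maximalIdeal (Localization.AtPrime 𝔪) := by
    intro i; fin_cases i
    · simpa [ha₁] using Ideal.mul_mem_left _ _ (hxgS' 0)
    · simpa [ha₂] using Ideal.mul_mem_left _ _ (hxgS' 1)
  have hxgU : ∀ i, (![algebraMap A (Localization.AtPrime 𝔪) (s₁ : A) * xS, algebraMap A (Localization.AtPrime 𝔪) (s₂ : A) * gS] : Fin 2 → (Localization.AtPrime 𝔪)) i ∈ maximalIdeal (Localization.AtPrime 𝔪) := by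
    intro i; fin_cases i
    · exact Ideal.mul_mem_left _ _ (hxgS' 0)
    · exact Ideal.mul_mem_left _ _ (hxgS' 1)
  have hliU := linearIndependent_toCotangent_pair_unit_mul hu₁ hu₂ hxgS' hliS' hxgU
  have hlia : LinearIndependent (ResidueField (Localization.AtPrime 𝔪)) fun i =>
      (maximalIdeal (Localization.AtPrime 𝔪)).toCotangent ⟨algebraMap A (Localization.AtPrime 𝔪) ((![a₁, a₂] : Fin 2 → A) i), hUa i⟩ := by
    have hfun : (fun i => (maximalIdeal (Localization.AtPrime 𝔪)).toCotangent
        ⟨(![algebraMap A (Localization.AtPrime 𝔪) (s₁ : A) * xS, algebraMap A (Localization.AtPrime 𝔪) (s₂ : A) * gS] : Fin 2 → (Localization.AtPrime 𝔪)) i, hxgU i⟩) =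
        (fun i => (maximalIdeal (Localization.AtPrime 𝔪)).toCotangent ⟨algebraMap A (Localization.AtPrime 𝔪) ((![a₁, a₂] : Fin 2 → A) i), hUa i⟩) := by
      funext i; fin_cases i
      · exact congrArg _ (Subtype.ext ha₁.symm)
      · exact congrArg _ (Subtype.ext ha₂.symm)
    rw [← hfun]; exact hliU
  have hspanA : Ideal.span {algebraMap A (Localization.AtPrime 𝔪) a₁, algebraMap A (Localization.AtPrime 𝔪) a₂} = (Ideal.map (algebraMap A (Localization.AtPrime 𝔪)) 𝔭) := by
    rw [ha₁, ha₂, span_pair_unit_mul hu₁ hu₂, hPS']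
  have hxga𝔪 : (Ideal.span {a₁, a₂}).map (algebraMap A (Localization.AtPrime 𝔪)) = 𝔭.map (algebraMap A (Localization.AtPrime 𝔪)) := by
    rw [Ideal.map_span, Set.image_pair, hspanA]
  -- the pair read in `A_𝔭` through `e`
  have hunitR₁ : IsUnit (e (algebraMap (Localization.AtPrime 𝔪) (Localization.AtPrime (Ideal.map (algebraMap A (Localization.AtPrime 𝔪)) 𝔭)) (algebraMap A (Localization.AtPrime 𝔪) (s₁ : A)))) := (hu₁.map _).map e
  have hunitR₂ : IsUnit (e (algebraMap (Localization.AtPrime 𝔪) (Localization.AtPrime (Ideal.map (algebraMap A (Localization.AtPrime 𝔪)) 𝔭)) (algebraMap A (Localization.AtPrime 𝔪) (s₂ : A)))) := (hu₂.map _).map e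
  have hea₁ : algebraMap A (Localization.AtPrime 𝔭) a₁ = e (algebraMap (Localization.AtPrime 𝔪) (Localization.AtPrime (Ideal.map (algebraMap A (Localization.AtPrime 𝔪)) 𝔭)) (algebraMap A (Localization.AtPrime 𝔪) (s₁ : A))) * e (algebraMap (Localization.AtPrime 𝔪) (Localization.AtPrime (Ideal.map (algebraMap A (Localization.AtPrime 𝔪)) 𝔭)) xS) := by
    rw [← he a₁, htower a₁, ha₁, map_mul, map_mul]
  have hea₂ : algebraMap A (Localization.AtPrime 𝔭) a₂ = e (algebraMap (Localization.AtPrime 𝔪) (Localization.AtPrime (Ideal.map (algebraMap A (Localization.AtPrime 𝔪)) 𝔭)) (algebraMap A (Localization.AtPrime 𝔪) (s₂ : A))) * e (algebraMap (Localization.AtPrime 𝔪) (Localization.AtPrime (Ideal.map (algebraMap A (Localization.AtPrime 𝔪)) 𝔭)) gS) := by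
    rw [← he a₂, htower a₂, ha₂, map_mul, map_mul]
  have hxga𝔭 : (Ideal.span {a₁, a₂}).map (algebraMap A (Localization.AtPrime 𝔭)) = maximalIdeal (Localization.AtPrime 𝔭) := by
    rw [Ideal.map_span, Set.image_pair, hea₁, hea₂, span_pair_unit_mul hunitR₁ hunitR₂, ← Set.image_pair, ← Ideal.map_span,
      ← Set.image_pair, ← Ideal.map_span, hPS', Localization.AtPrime.map_eq_maximalIdeal, map_ringEquiv_maximalIdeal]
  -- the terminal level transported to `A_𝔭`
  have hFe : e (algebraMap (Localization.AtPrime 𝔪) (Localization.AtPrime (Ideal.map (algebraMap A (Localization.AtPrime 𝔪)) 𝔭)) (algebraMap A (Localization.AtPrime 𝔪) F)) = algebraMap A (Localization.AtPrime 𝔭) F := by rw [hFR, he]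
  have hreachA : algebraMap A (Localization.AtPrime 𝔭) F ∈
      contactFiltration (algebraMap A (Localization.AtPrime 𝔭) a₂) (bMax (algebraMap A (Localization.AtPrime 𝔭) F))
        (bMax (algebraMap A (Localization.AtPrime 𝔭) F) * (adicOrder (algebraMap A (Localization.AtPrime 𝔭) F)).toNat) := by
    rw [hea₂, contactFiltration_unit_mul hunitR₂, ← hFe, bMax_ringEquiv, adicOrder_map_ringEquiv,
      apply_mem_contactFiltration_iff]
    exact hreachS
  have hbA : 1 ≤ bMax (algebraMap A (Localization.AtPrime 𝔭) F) := by rw [← hFe, bMax_ringEquiv]; exact hbR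
  have hF0𝔪 : algebraMap A (Localization.AtPrime 𝔪) F ≠ 0 := fun h => hf0R (by rw [h, map_zero])
  -- the (open″) body for the numerators
  obtain ⟨h, hh, -, H⟩ := jOpenPresentation_body_cylinder_iotaOrd k A 𝔪 F hF0𝔪 hF2𝔪 𝔭 h𝔭𝔪 hdim𝔭 a₁ a₂ hxga𝔭 hxga𝔪
    hUa hlia hF0 hnm hreachA hstrat
  exact ⟨a₁, a₂, hxga𝔪, ⟨hUa, hlia⟩, h, hh, hbA, H⟩

end ContactCylinder

end Summit.ResolutionOfSingularities.ResolutionOfSingularities.Theorems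

end
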